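import Mathlib.Algebra.Group.Basic
import Mathlib.Algebra.BigOperators.Group.Finset.Basic
import Mathlib.Algebra.Order.BigOperators.Group.Finset
import Mathlib.Data.Finset.Card
import Mathlib.Data.Fintype.Card
import Mathlib.Tactic.Group
import HarnessLib

/-!
# The left stabiliser of `T₀ ∩ T₀ w`: a usable right translate `w` with `2·|Stab_L(T₀ ∩ T₀ w)| ≤ |T₀ ∖ T₀ w|` always exists

COR-CM (cell `pub-hodgecm2`), binder seat b04 (gen 32), count-neutral own lane «Galois-CM-type classification»: the GROUP
COMBINATORICS behind the unconditional quadratic case of monotonicity («BAD(K₀) ⟹ BAD(K)» for `[K:K₀] = 2`, sequel file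
`CorCM/GaloisDegenerateQuadraticExtension`).  KERNEL ONLY, Mathlib only: theorems; no definition, no named fact, no `sorry`.

SETTING.  `Q` a finite group, `c₀ ∈ Q` a central involution, `T₀ ⊂ Q` a CM set (`q ∈ T₀ ↔ c₀ q ∉ T₀`) with trivial left
stabiliser.  For `w ∈ Q` put `F = T₀ ∩ T₀w = {q ∈ T₀ : q w⁻¹ ∈ T₀}`, `D₁ = T₀ ∖ T₀w`, and `A = Stab_L(F) = {v : vF = F}` (all as
`Finset.filter` expressions — no definitions).  The lifted CM sets of the quadratic lift (`CorCM/GaloisQuadraticPattern`) with full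
fibres over `F` and one point per fibre over `D₁ ⊔ c₀D₁` can only be stabilised by elements over `A`; the counting of
`CorCM/GaloisSectionCount` then succeeds as soon as `2|A| ≤ |D₁|` (instead of the global `|G| ≤ 2^(|Q|/8)` of
`CorCM/GaloisCertificateQuadraticLift`).  This file proves that such a `w` exists whenever `|T₀| ≥ 5`:

* `card_leftStab_le` / `exists_of_card_leftStab_eq` — `|Stab_L(X)| ≤ |X|`, with equality only if `X = Stab_L(X)·x₀`.
* `exists_usable` — a left-primitive `T₀` with `|T₀| ≥ 2` has `w` with `F ≠ ∅ ≠ D₁` (no exponent hypothesis: otherwise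
  `T₀T₀⁻¹T₀ = T₀` and `t₁t₂⁻¹` stabilises `T₀`).
* `card_leftStab_dvd` — `|A| ∣ |D₁|`: `A` acts FREELY on `D₁` by `ψ_v(z) ∈ {vz, c₀vz}`.
* `false_of_regular` — if `A` is regular on `F` AND `Stab_L(D₁)` is regular on `D₁` with `|D₁| ≥ 3`, contradiction: then
  `T₀ = Aq₀ ⊔ A'p₀`, `A ∩ A' = 1` by primitivity, `A' ⊆ A ∪ c₀A`, and `(u,v') ↦ uv'` injects `A × A'` into `A ∪ c₀A`.
* **`exists_good_translate`** — `|T₀| ≥ 5` ⟹ some `w` has `F ≠ ∅`, `D₁ ≠ ∅` and `2·|Stab_L(F)| ≤ |D₁|`.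

## References

* [Kubota1965] T. Kubota, *On the field extension by complex multiplication*, Trans. AMS 118 (1965), §2 (context only; the
  lemmas are elementary group combinatorics).
-/

namespace Summit.HodgeConjecture.CorCM.GaloisModels.QuadraticStabiliser

open Finset

variable {Q : Type*} [Group Q] [Fintype Q] [DecidableEq Q]

/-! ## §1 The left stabiliser of a finite set -/

omit [Fintype Q] [DecidableEq Q] in
/-- Stabilisers are closed under products. [folklore] -/
theorem leftStab_mul {X : Finset Q} {u v : Q} (hu : ∀ x, x ∈ X ↔ u * x ∈ X) (hv : ∀ x, x ∈ X ↔ v * x ∈ X) (x : Q) :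
    x ∈ X ↔ u * v * x ∈ X := by rw [mul_assoc, ← hu, ← hv]

omit [Fintype Q] [DecidableEq Q] in
/-- Stabilisers are closed under inverses. [folklore] -/
theorem leftStab_inv {X : Finset Q} {v : Q} (hv : ∀ x, x ∈ X ↔ v * x ∈ X) (x : Q) : x ∈ X ↔ v⁻¹ * x ∈ X := by
  rw [hv (v⁻¹ * x), mul_inv_cancel_left]

/-- `|Stab_L(X)| ≤ |X|` for `X ≠ ∅` (`v ↦ v x₀` is injective into `X`). [folklore] -/
theorem card_leftStab_le (X : Finset Q) {x₀ : Q} (hx₀ : x₀ ∈ X) :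
    (univ.filter fun v : Q => ∀ x, x ∈ X ↔ v * x ∈ X).card ≤ X.card := by
  calc (univ.filter fun v : Q => ∀ x, x ∈ X ↔ v * x ∈ X).card
      = ((univ.filter fun v : Q => ∀ x, x ∈ X ↔ v * x ∈ X).image fun v => v * x₀).card :=
        (card_image_of_injective _ (mul_left_injective x₀)).symm
    _ ≤ X.card := card_le_card fun y hy => by
        obtain ⟨v, hv, rfl⟩ := mem_image.1 hy
        exact ((mem_filter.1 hv).2 x₀).1 hx₀

/-- If `|Stab_L(X)| = |X|` then `X = Stab_L(X) · x₀` for any `x₀ ∈ X`. [folklore] -/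
theorem exists_of_card_leftStab_eq (X : Finset Q) {x₀ : Q} (hx₀ : x₀ ∈ X)
    (h : (univ.filter fun v : Q => ∀ x, x ∈ X ↔ v * x ∈ X).card = X.card) {y : Q} (hy : y ∈ X) :
    ∃ v, (∀ x, x ∈ X ↔ v * x ∈ X) ∧ y = v * x₀ := by
  have hsub : ((univ.filter fun v : Q => ∀ x, x ∈ X ↔ v * x ∈ X).image fun v => v * x₀) ⊆ X := fun y hy => by
    obtain ⟨v, hv, rfl⟩ := mem_image.1 hy
    exact ((mem_filter.1 hv).2 x₀).1 hx₀
  have heq := eq_of_subset_of_card_le hsub (by rw [card_image_of_injective _ (mul_left_injective x₀), h])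
  rw [← heq] at hy
  obtain ⟨v, hv, rfl⟩ := mem_image.1 hy
  exact ⟨v, (mem_filter.1 hv).2, rfl⟩

/-! ## §2 A usable right translate -/

/-- **A left-primitive set with at least two elements has a right translate `T₀ w ∉ {T₀, Q ∖ T₀}`-wise position: `T₀ ∩ T₀w ≠ ∅` and
`T₀ ⊄ T₀ w`.**  Otherwise `T₀ T₀⁻¹ T₀ ⊆ T₀`, so `t₁ t₂⁻¹` stabilises `T₀` for all `t₁, t₂ ∈ T₀`. [folklore] -/
theorem exists_usable (T₀ : Finset Q) (hprim : ∀ v : Q, v ≠ 1 → ∃ q : Q, ¬ (q ∈ T₀ ↔ v * q ∈ T₀)) (h2 : 1 < T₀.card) :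
    ∃ w : Q, (∃ q, q ∈ T₀ ∧ q * w⁻¹ ∈ T₀) ∧ (∃ q, q ∈ T₀ ∧ q * w⁻¹ ∉ T₀) := by
  by_contra H
  obtain ⟨t₁, ht₁, t₂, ht₂, hne⟩ := one_lt_card.1 h2
  have fwd : ∀ q, q ∈ T₀ → t₁ * t₂⁻¹ * q ∈ T₀ := by
    intro q hq
    by_contra hq'
    refine H ⟨q⁻¹ * t₂, ⟨t₂, ht₂, ?_⟩, ⟨t₁, ht₁, ?_⟩⟩
    · rw [mul_inv_rev, inv_inv, mul_inv_cancel_left]; exact hq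
    · rw [mul_inv_rev, inv_inv, ← mul_assoc]; exact hq'
  have himg : T₀.image (fun q => t₁ * t₂⁻¹ * q) = T₀ :=
    eq_of_subset_of_card_le (fun y hy => by obtain ⟨q, hq, rfl⟩ := mem_image.1 hy; exact fwd q hq)
      (by rw [card_image_of_injective _ (mul_right_injective _)])
  obtain ⟨q, hq⟩ := hprim (t₁ * t₂⁻¹) (fun h => hne (by rw [mul_inv_eq_one] at h; exact h))
  refine hq ⟨fwd q, fun h => ?_⟩
  rw [← himg] at h
  obtain ⟨q', hq', e⟩ := mem_image.1 h
  rw [← mul_right_injective _ e]; exact hq'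

/-! ## §3 The sets `F = T₀ ∩ T₀w`, `D₁ = T₀ ∖ T₀w`; the swap `w ↦ c₀ w` -/

omit [Fintype Q] [DecidableEq Q] in
/-- `c₀ q ∈ T₀ ↔ q ∉ T₀` for a CM set. [folklore] -/
theorem cm_mul_mem_iff {c₀ : Q} {T₀ : Finset Q} (hcm : ∀ q : Q, q ∈ T₀ ↔ c₀ * q ∉ T₀) (q : Q) : c₀ * q ∈ T₀ ↔ q ∉ T₀ :=
  ⟨fun h hq => (hcm q).1 hq h, fun h => not_not.1 fun h' => h ((hcm q).2 h')⟩

omit [Fintype Q] [DecidableEq Q] in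
/-- `q (c₀ w)⁻¹ = c₀ (q w⁻¹)` for a central involution `c₀`. [folklore] -/
theorem mul_inv_central (c₀ : Q) (hc : c₀ * c₀ = 1) (hcomm : ∀ q, c₀ * q = q * c₀) (q w : Q) :
    q * (c₀ * w)⁻¹ = c₀ * (q * w⁻¹) := by
  rw [mul_inv_rev, ← mul_assoc, hcomm, show c₀⁻¹ = c₀ from inv_eq_of_mul_eq_one_right hc, mul_assoc]

omit [Fintype Q] in
/-- `T₀ ∩ T₀ c₀w = T₀ ∖ T₀ w`. [folklore] -/
theorem filter_swap_mem (c₀ : Q) (hc : c₀ * c₀ = 1) (hcomm : ∀ q, c₀ * q = q * c₀) (T₀ : Finset Q)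
    (hcm : ∀ q : Q, q ∈ T₀ ↔ c₀ * q ∉ T₀) (w : Q) :
    (T₀.filter fun q => q * (c₀ * w)⁻¹ ∈ T₀) = T₀.filter fun q => q * w⁻¹ ∉ T₀ := by
  ext q; simp only [mem_filter, mul_inv_central c₀ hc hcomm, cm_mul_mem_iff hcm]

omit [Fintype Q] in
/-- `T₀ ∖ T₀ c₀w = T₀ ∩ T₀ w`. [folklore] -/
theorem filter_swap_not_mem (c₀ : Q) (hc : c₀ * c₀ = 1) (hcomm : ∀ q, c₀ * q = q * c₀) (T₀ : Finset Q)
    (hcm : ∀ q : Q, q ∈ T₀ ↔ c₀ * q ∉ T₀) (w : Q) :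
    (T₀.filter fun q => q * (c₀ * w)⁻¹ ∉ T₀) = T₀.filter fun q => q * w⁻¹ ∈ T₀ := by
  ext q; simp only [mem_filter, mul_inv_central c₀ hc hcomm, cm_mul_mem_iff hcm, not_not]

/-! ## §4 `Stab_L(F)` acts freely on `D₁`: `|Stab_L(F)|` divides `|D₁|` -/

/-- **`|Stab_L(T₀ ∩ T₀w)|` divides `|T₀ ∖ T₀w|`** (when `T₀ ∩ T₀ w ≠ ∅`): `v ∈ Stab_L(F)` acts on `D₁ = T₀ ∖ T₀w` by `ψ_v z =` the
element of `{vz, c₀vz}` in `T₀` (it lies in `D₁`), freely, and `D₁` is the disjoint union of the orbits. [folklore] -/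
theorem card_leftStab_dvd (c₀ : Q) (hc : c₀ * c₀ = 1) (hcomm : ∀ q, c₀ * q = q * c₀) (T₀ : Finset Q)
    (hcm : ∀ q : Q, q ∈ T₀ ↔ c₀ * q ∉ T₀) (w : Q) (hF : ∃ q, q ∈ T₀ ∧ q * w⁻¹ ∈ T₀) :
    (univ.filter fun v : Q => ∀ x, x ∈ T₀.filter (fun q => q * w⁻¹ ∈ T₀) ↔
        v * x ∈ T₀.filter (fun q => q * w⁻¹ ∈ T₀)).card ∣ (T₀.filter fun q => q * w⁻¹ ∉ T₀).card := by
  classical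
  set F := T₀.filter fun q => q * w⁻¹ ∈ T₀ with hFdef
  set D₁ := T₀.filter fun q => q * w⁻¹ ∉ T₀ with hD₁
  set A := univ.filter fun v : Q => ∀ x, x ∈ F ↔ v * x ∈ F with hAdef
  have hA : ∀ v, v ∈ A ↔ ∀ x, x ∈ F ↔ v * x ∈ F := fun v => by rw [hAdef, mem_filter, and_iff_right (mem_univ v)]
  have hmF : ∀ q, q ∈ F ↔ q ∈ T₀ ∧ q * w⁻¹ ∈ T₀ := fun q => by rw [hFdef, mem_filter]
  have hmD : ∀ q, q ∈ D₁ ↔ q ∈ T₀ ∧ q * w⁻¹ ∉ T₀ := fun q => by rw [hD₁, mem_filter]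
  have hcm' := cm_mul_mem_iff hcm
  have hcl : ∀ x y : Q, x * (c₀ * y) = c₀ * (x * y) := fun x y => by rw [← mul_assoc, ← hcomm, mul_assoc]
  obtain ⟨q₀, hq₀, hq₀w⟩ := hF
  have hq₀F : q₀ ∈ F := (hmF q₀).2 ⟨hq₀, hq₀w⟩
  -- `c₀ u ∉ A` for `u ∈ A`
  have hcA : ∀ u v, u ∈ A → v ∈ A → v ≠ c₀ * u := by
    intro u v hu hv h
    have h1 : ∀ x, x ∈ F ↔ c₀ * x ∈ F := fun x => by
      rw [show c₀ = v * u⁻¹ by rw [h, mul_inv_cancel_right]]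
      exact leftStab_mul ((hA v).1 hv) (leftStab_inv ((hA u).1 hu)) x
    exact (hcm q₀).1 hq₀ ((hmF _).1 ((h1 q₀).1 hq₀F)).1
  -- the action
  set ψ : Q → Q → Q := fun v z => if v * z ∈ T₀ then v * z else c₀ * (v * z) with hψ
  have hψ_cases : ∀ v z, ψ v z = v * z ∨ ψ v z = c₀ * (v * z) := fun v z => by
    simp only [hψ]; split_ifs <;> simp
  have hψT : ∀ v z, ψ v z ∈ T₀ := fun v z => by
    simp only [hψ]; split_ifs with h
    · exact h
    · exact (hcm' _).2 h
  have hψD : ∀ v ∈ A, ∀ z ∈ D₁, ψ v z ∈ D₁ := by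
    intro v hv z hz
    obtain ⟨hzT, hzw⟩ := (hmD z).1 hz
    have hv' := (hA v).1 hv
    have n1 : v * z ∉ F := fun h => hzw ((hmF z).1 ((hv' z).2 h)).2
    have n2 : c₀ * (v * z) ∉ F := fun h => by
      rw [← mul_assoc, hcomm, mul_assoc] at h
      exact (hcm z).1 hzT ((hmF _).1 ((hv' _).2 h)).1
    refine (hmD _).2 ⟨hψT v z, fun h => ?_⟩
    rcases hψ_cases v z with e | e <;> rw [e] at h
    · exact n1 ((hmF _).2 ⟨by have := hψT v z; rwa [e] at this, h⟩)
    · exact n2 ((hmF _).2 ⟨by have := hψT v z; rwa [e] at this, h⟩)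
  -- uniqueness of the representative in `T₀`
  have huniq : ∀ x y : Q, (x = y ∨ x = c₀ * y) → ∀ x', (x' = y ∨ x' = c₀ * y) → x ∈ T₀ → x' ∈ T₀ → x = x' := by
    rintro x y (rfl | rfl) x' (rfl | rfl) hx hx'
    · rfl
    · exact absurd hx' ((hcm _).1 hx)
    · exact absurd hx ((hcm _).1 hx')
    · rfl
  have hψ_mul : ∀ u v z, z ∈ D₁ → ψ u (ψ v z) = ψ (u * v) z := by
    intro u v z hz
    refine huniq _ (u * v * z) ?_ _ (hψ_cases (u * v) z) (hψT _ _) (hψT _ _)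
    rcases hψ_cases v z with e | e <;> rcases hψ_cases u (ψ v z) with e' | e' <;> rw [e', e]
    · exact Or.inl (mul_assoc _ _ _).symm
    · exact Or.inr (by rw [← mul_assoc u v z])
    · exact Or.inr (by rw [hcl, mul_assoc u v z])
    · exact Or.inl (by rw [hcl u, ← mul_assoc c₀ c₀, hc, one_mul, ← mul_assoc])
  have hψ_one : ∀ z ∈ D₁, ψ 1 z = z := fun z hz => by
    simp only [hψ, one_mul, if_pos ((hmD z).1 hz).1]
  have hψ_inj : ∀ z ∈ D₁, Set.InjOn (fun v => ψ v z) A := by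
    intro z _ u hu v hv h
    rcases hψ_cases u z with e | e <;> rcases hψ_cases v z with e' | e' <;> simp only [e, e'] at h
    · exact mul_right_cancel h
    · exact absurd (mul_right_cancel (h.trans (mul_assoc _ _ _).symm)) (hcA v u hv hu)
    · exact absurd (mul_right_cancel (h.symm.trans (mul_assoc _ _ _).symm)) (hcA u v hu hv)
    · exact mul_right_cancel (mul_left_cancel h)
  -- orbits
  set orb : Q → Finset Q := fun z => A.image fun v => ψ v z with horb
  have horb_card : ∀ z ∈ D₁, (orb z).card = A.card := fun z hz => card_image_of_injOn (hψ_inj z hz)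
  have horb_sub : ∀ z ∈ D₁, orb z ⊆ D₁ := fun z hz x hx => by
    obtain ⟨v, hv, rfl⟩ := mem_image.1 hx; exact hψD v hv z hz
  have hmem_orb : ∀ z ∈ D₁, z ∈ orb z := fun z hz =>
    mem_image.2 ⟨1, (hA 1).2 fun x => by rw [one_mul], hψ_one z hz⟩
  have horb_eq : ∀ z ∈ D₁, ∀ z' ∈ orb z, orb z' = orb z := by
    intro z hz z' hz'
    obtain ⟨v, hv, rfl⟩ := mem_image.1 hz'
    ext x; simp only [horb, mem_image]
    constructor
    · rintro ⟨u, hu, rfl⟩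
      exact ⟨u * v, (hA _).2 (leftStab_mul ((hA u).1 hu) ((hA v).1 hv)), (hψ_mul u v z hz).symm⟩
    · rintro ⟨u, hu, rfl⟩
      refine ⟨u * v⁻¹, (hA _).2 (leftStab_mul ((hA u).1 hu) (leftStab_inv ((hA v).1 hv))), ?_⟩
      rw [hψ_mul _ _ z hz, inv_mul_cancel_right]
  -- fibrewise count
  have hsum := card_eq_sum_card_fiberwise (f := orb) (s := D₁) (t := D₁.image orb) fun z hz => mem_image_of_mem orb hz
  have hfib : ∀ O ∈ D₁.image orb, (D₁.filter fun z => orb z = O).card = A.card := by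
    intro O hO
    obtain ⟨z₀, hz₀, rfl⟩ := mem_image.1 hO
    rw [← horb_card z₀ hz₀]
    congr 1; ext z; simp only [mem_filter]
    constructor
    · rintro ⟨hz, he⟩; rw [← he]; exact hmem_orb z hz
    · intro hz; exact ⟨horb_sub z₀ hz₀ hz, horb_eq z₀ hz₀ z hz⟩
  rw [hsum, sum_const_nat hfib]
  exact Dvd.intro_left _ rfl

/-! ## §5 The regular case is impossible -/

/-- **If `Stab_L(F)` is transitive on `F = T₀ ∩ T₀w ≠ ∅` and `Stab_L(D₁)` is transitive on `D₁ = T₀ ∖ T₀w` with `|D₁| ≥ 3`, a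
left-primitive CM set `T₀` cannot exist.**  (`T₀ = A q₀ ⊔ A' p₀`; `A ∩ A' = 1`; `A' ⊆ A ∪ c₀A`; `|A|·|A'| ≤ 2|A|`.) [folklore] -/
theorem false_of_regular (c₀ : Q) (hc : c₀ * c₀ = 1) (hcomm : ∀ q, c₀ * q = q * c₀) (T₀ : Finset Q)
    (hcm : ∀ q : Q, q ∈ T₀ ↔ c₀ * q ∉ T₀) (hprim : ∀ v : Q, v ≠ 1 → ∃ q : Q, ¬ (q ∈ T₀ ↔ v * q ∈ T₀)) (w : Q)
    (hF : ∃ q, q ∈ T₀ ∧ q * w⁻¹ ∈ T₀) (hD : ∃ q, q ∈ T₀ ∧ q * w⁻¹ ∉ T₀)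
    (hA : (univ.filter fun v : Q => ∀ x, x ∈ T₀.filter (fun q => q * w⁻¹ ∈ T₀) ↔
        v * x ∈ T₀.filter (fun q => q * w⁻¹ ∈ T₀)).card = (T₀.filter fun q => q * w⁻¹ ∈ T₀).card)
    (hA' : (univ.filter fun v : Q => ∀ x, x ∈ T₀.filter (fun q => q * w⁻¹ ∉ T₀) ↔
        v * x ∈ T₀.filter (fun q => q * w⁻¹ ∉ T₀)).card = (T₀.filter fun q => q * w⁻¹ ∉ T₀).card)
    (h3 : 3 ≤ (T₀.filter fun q => q * w⁻¹ ∉ T₀).card) : False := by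
  classical
  set F := T₀.filter fun q => q * w⁻¹ ∈ T₀ with hFdef
  set D₁ := T₀.filter fun q => q * w⁻¹ ∉ T₀ with hD₁
  set A := univ.filter fun v : Q => ∀ x, x ∈ F ↔ v * x ∈ F with hAdef
  set A' := univ.filter fun v : Q => ∀ x, x ∈ D₁ ↔ v * x ∈ D₁ with hA'def
  have hmA : ∀ v, v ∈ A ↔ ∀ x, x ∈ F ↔ v * x ∈ F := fun v => by rw [hAdef, mem_filter, and_iff_right (mem_univ v)]
  have hmA' : ∀ v, v ∈ A' ↔ ∀ x, x ∈ D₁ ↔ v * x ∈ D₁ := fun v => by rw [hA'def, mem_filter, and_iff_right (mem_univ v)]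
  have hmF : ∀ q, q ∈ F ↔ q ∈ T₀ ∧ q * w⁻¹ ∈ T₀ := fun q => by rw [hFdef, mem_filter]
  have hmD : ∀ q, q ∈ D₁ ↔ q ∈ T₀ ∧ q * w⁻¹ ∉ T₀ := fun q => by rw [hD₁, mem_filter]
  obtain ⟨q₀, hq₀, hq₀w⟩ := hF
  obtain ⟨p₀, hp₀, hp₀w⟩ := hD
  have hq₀F : q₀ ∈ F := (hmF q₀).2 ⟨hq₀, hq₀w⟩
  have hp₀D : p₀ ∈ D₁ := (hmD p₀).2 ⟨hp₀, hp₀w⟩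
  have hcl : ∀ x y : Q, x * (c₀ * y) = c₀ * (x * y) := fun x y => by rw [← mul_assoc, ← hcomm, mul_assoc]
  have hT : ∀ q, q ∈ T₀ ↔ q ∈ F ∨ q ∈ D₁ := fun q => by
    rw [hmF, hmD]; by_cases h : q * w⁻¹ ∈ T₀ <;> simp [h]
  -- (1) `A ∩ A' = 1`
  have hmeet : ∀ v, v ∈ A → v ∈ A' → v = 1 := by
    intro v hv hv'
    by_contra hne
    obtain ⟨q, hq⟩ := hprim v hne
    exact hq (by rw [hT, hT, (hmA v).1 hv q, (hmA' v).1 hv' q])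
  -- (2) `A' ⊆ A ∪ c₀ A`
  have hsub : ∀ v', v' ∈ A' → v' ∈ A ∨ c₀ * v' ∈ A := by
    intro v' hv'
    have hv'' := (hmA' v').1 hv'
    -- `q₀ ∉ A' p₀` and `q₀ ∉ c₀ A' p₀`
    have key : ∀ t, (∀ x, x ∈ D₁ ↔ t * x ∈ D₁) → t * q₀ ∉ D₁ ∧ c₀ * (t * q₀) ∉ D₁ := by
      intro t ht
      constructor
      · intro h
        obtain ⟨u, hu, e⟩ := exists_of_card_leftStab_eq D₁ hp₀D hA' h
        have : q₀ ∈ D₁ := by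
          have e' : q₀ = t⁻¹ * u * p₀ := by rw [mul_assoc, ← e, inv_mul_cancel_left]
          rw [e']; exact (leftStab_mul (leftStab_inv ht) hu p₀).1 hp₀D
        exact ((hmD q₀).1 this).2 hq₀w
      · intro h
        obtain ⟨u, hu, e⟩ := exists_of_card_leftStab_eq D₁ hp₀D hA' h
        have e' : q₀ = c₀ * (t⁻¹ * u * p₀) := by
          rw [mul_assoc t⁻¹, ← e, hcl t⁻¹, inv_mul_cancel_left, ← mul_assoc, hc, one_mul]
        have hin : t⁻¹ * u * p₀ ∈ T₀ := ((hmD _).1 ((leftStab_mul (leftStab_inv ht) hu p₀).1 hp₀D)).1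
        exact (hcm _).1 hin (by rw [← e']; exact hq₀)
    obtain ⟨k1, k2⟩ := key v' hv''
    by_cases h1 : v' * q₀ ∈ T₀
    · rcases (hT _).1 h1 with h | h
      · obtain ⟨u, hu, e⟩ := exists_of_card_leftStab_eq F hq₀F hA h
        exact Or.inl ((hmA _).2 (by rw [mul_right_cancel e]; exact hu))
      · exact absurd h k1
    · have h2 : c₀ * (v' * q₀) ∈ T₀ := (cm_mul_mem_iff hcm _).2 h1
      rcases (hT _).1 h2 with h | h
      · obtain ⟨u, hu, e⟩ := exists_of_card_leftStab_eq F hq₀F hA h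
        rw [← mul_assoc] at e
        exact Or.inr ((hmA _).2 (by rw [mul_right_cancel e]; exact hu))
      · exact absurd h k2
  -- (3) `(u, v') ↦ u v'` injects `A × A'` into `A ∪ c₀ A`
  have hinj : Set.InjOn (fun p : Q × Q => p.1 * p.2) (A ×ˢ A' : Finset (Q × Q)) := by
    rintro ⟨u, v'⟩ huv ⟨u₂, v₂'⟩ huv₂ (h : u * v' = u₂ * v₂')
    rw [Finset.mem_coe, mem_product] at huv huv₂
    have e : u₂⁻¹ * u = v₂' * v'⁻¹ := calc
      u₂⁻¹ * u = u₂⁻¹ * (u * v') * v'⁻¹ := by group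
      _ = u₂⁻¹ * (u₂ * v₂') * v'⁻¹ := by rw [h]
      _ = v₂' * v'⁻¹ := by group
    have h1 : u₂⁻¹ * u = 1 := hmeet _
      ((hmA _).2 (leftStab_mul (leftStab_inv ((hmA _).1 huv₂.1)) ((hmA _).1 huv.1)))
      (by rw [e]; exact (hmA' _).2 (leftStab_mul ((hmA' _).1 huv₂.2) (leftStab_inv ((hmA' _).1 huv.2))))
    have hu : u = u₂ := by rw [inv_mul_eq_one] at h1; exact h1.symm
    subst hu
    exact Prod.ext rfl (mul_left_cancel h)
  have himg : ∀ p ∈ (A ×ˢ A' : Finset (Q × Q)), (fun p : Q × Q => p.1 * p.2) p ∈ A ∪ A.image fun v => c₀ * v := by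
    rintro ⟨u, v'⟩ huv
    rw [mem_product] at huv
    rcases hsub v' huv.2 with h | h
    · exact mem_union_left _ ((hmA _).2 (leftStab_mul ((hmA u).1 huv.1) ((hmA _).1 h)))
    · refine mem_union_right _ (mem_image.2 ⟨u * (c₀ * v'), (hmA _).2 (leftStab_mul ((hmA u).1 huv.1) ((hmA _).1 h)), ?_⟩)
      show c₀ * (u * (c₀ * v')) = u * v'
      rw [hcl, ← mul_assoc, hc, one_mul]
  have hle := card_le_card_of_injOn _ himg hinj
  rw [card_product, hA, hA'] at hle
  have hle' : F.card * D₁.card ≤ F.card * 2 :=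
    hle.trans ((card_union_le _ _).trans (by have := card_image_le (s := A) (f := fun v => c₀ * v); omega))
  have hFpos : 0 < F.card := card_pos.2 ⟨q₀, hq₀F⟩
  have := Nat.le_of_mul_le_mul_left hle' hFpos
  omega

/-! ## §6 Assembly -/

/-- **A usable translate with small stabiliser.**  For a central involution `c₀`, a CM set `T₀` with trivial left stabiliser and
`|T₀| ≥ 5`, some `w` has `T₀ ∩ T₀w ≠ ∅`, `T₀ ∖ T₀ w ≠ ∅` and `2·|Stab_L(T₀ ∩ T₀w)| ≤ |T₀ ∖ T₀w|`. [folklore] -/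
theorem exists_good_translate (c₀ : Q) (hc : c₀ * c₀ = 1) (hcomm : ∀ q, c₀ * q = q * c₀) (T₀ : Finset Q)
    (hcm : ∀ q : Q, q ∈ T₀ ↔ c₀ * q ∉ T₀) (hprim : ∀ v : Q, v ≠ 1 → ∃ q : Q, ¬ (q ∈ T₀ ↔ v * q ∈ T₀))
    (h5 : 5 ≤ T₀.card) :
    ∃ w : Q, (∃ q, q ∈ T₀ ∧ q * w⁻¹ ∈ T₀) ∧ (∃ q, q ∈ T₀ ∧ q * w⁻¹ ∉ T₀) ∧
      2 * (univ.filter fun v : Q => ∀ x, x ∈ T₀.filter (fun q => q * w⁻¹ ∈ T₀) ↔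
        v * x ∈ T₀.filter (fun q => q * w⁻¹ ∈ T₀)).card ≤ (T₀.filter fun q => q * w⁻¹ ∉ T₀).card := by
  classical
  -- it suffices to treat `w` with `|F| ≤ |D₁|`
  suffices key : ∀ w : Q, (∃ q, q ∈ T₀ ∧ q * w⁻¹ ∈ T₀) → (∃ q, q ∈ T₀ ∧ q * w⁻¹ ∉ T₀) →
      (T₀.filter fun q => q * w⁻¹ ∈ T₀).card ≤ (T₀.filter fun q => q * w⁻¹ ∉ T₀).card →
      ∃ w : Q, (∃ q, q ∈ T₀ ∧ q * w⁻¹ ∈ T₀) ∧ (∃ q, q ∈ T₀ ∧ q * w⁻¹ ∉ T₀) ∧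
        2 * (univ.filter fun v : Q => ∀ x, x ∈ T₀.filter (fun q => q * w⁻¹ ∈ T₀) ↔
          v * x ∈ T₀.filter (fun q => q * w⁻¹ ∈ T₀)).card ≤ (T₀.filter fun q => q * w⁻¹ ∉ T₀).card by
    obtain ⟨w₀, hF₀, hD₀⟩ := exists_usable T₀ hprim (by omega)
    by_cases hle : (T₀.filter fun q => q * w₀⁻¹ ∈ T₀).card ≤ (T₀.filter fun q => q * w₀⁻¹ ∉ T₀).card
    · exact key w₀ hF₀ hD₀ hle
    · refine key (c₀ * w₀) ?_ ?_ ?_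
      · obtain ⟨q, hq, hqw⟩ := hD₀
        exact ⟨q, hq, by rw [mul_inv_central c₀ hc hcomm]; exact (cm_mul_mem_iff hcm _).2 hqw⟩
      · obtain ⟨q, hq, hqw⟩ := hF₀
        exact ⟨q, hq, by rw [mul_inv_central c₀ hc hcomm]; exact (hcm _).1 hqw⟩
      · rw [filter_swap_mem c₀ hc hcomm T₀ hcm, filter_swap_not_mem c₀ hc hcomm T₀ hcm]; omega
  intro w hF hD hle
  have hsum := card_filter_add_card_filter_not (s := T₀) (fun q => q * w⁻¹ ∈ T₀)
  obtain ⟨q₀, hq₀, hq₀w⟩ := id hF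
  obtain ⟨p₀, hp₀, hp₀w⟩ := id hD
  have hq₀F : q₀ ∈ T₀.filter fun q => q * w⁻¹ ∈ T₀ := mem_filter.2 ⟨hq₀, hq₀w⟩
  have hp₀D : p₀ ∈ T₀.filter fun q => q * w⁻¹ ∉ T₀ := mem_filter.2 ⟨hp₀, hp₀w⟩
  have hdvd := card_leftStab_dvd c₀ hc hcomm T₀ hcm w hF
  have haF := card_leftStab_le (T₀.filter fun q => q * w⁻¹ ∈ T₀) hq₀F
  obtain ⟨k, hk⟩ := hdvd
  by_cases hlt : (univ.filter fun v : Q => ∀ x, x ∈ T₀.filter (fun q => q * w⁻¹ ∈ T₀) ↔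
      v * x ∈ T₀.filter (fun q => q * w⁻¹ ∈ T₀)).card < (T₀.filter fun q => q * w⁻¹ ∉ T₀).card
  · refine ⟨w, hF, hD, ?_⟩
    have hDpos := card_pos.2 ⟨p₀, hp₀D⟩
    have hk2 : 2 ≤ k := by
      by_contra hk2
      rcases (show k = 0 ∨ k = 1 by omega) with rfl | rfl
      · rw [mul_zero] at hk; omega
      · rw [mul_one] at hk; omega
    calc 2 * _ ≤ k * _ := Nat.mul_le_mul_right _ hk2
      _ = _ := by rw [mul_comm, ← hk]
  · -- the regular case: switch to `c₀ w`
    have heq : (univ.filter fun v : Q => ∀ x, x ∈ T₀.filter (fun q => q * w⁻¹ ∈ T₀) ↔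
        v * x ∈ T₀.filter (fun q => q * w⁻¹ ∈ T₀)).card = (T₀.filter fun q => q * w⁻¹ ∈ T₀).card := by omega
    have hFD : (T₀.filter fun q => q * w⁻¹ ∈ T₀).card = (T₀.filter fun q => q * w⁻¹ ∉ T₀).card := by omega
    have haD := card_leftStab_le (T₀.filter fun q => q * w⁻¹ ∉ T₀) hp₀D
    have hne : (univ.filter fun v : Q => ∀ x, x ∈ T₀.filter (fun q => q * w⁻¹ ∉ T₀) ↔
        v * x ∈ T₀.filter (fun q => q * w⁻¹ ∉ T₀)).card ≠ (T₀.filter fun q => q * w⁻¹ ∉ T₀).card :=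
      fun h => false_of_regular c₀ hc hcomm T₀ hcm hprim w hF hD heq h (by omega)
    have hF' : ∃ q, q ∈ T₀ ∧ q * (c₀ * w)⁻¹ ∈ T₀ :=
      ⟨p₀, hp₀, by rw [mul_inv_central c₀ hc hcomm]; exact (cm_mul_mem_iff hcm _).2 hp₀w⟩
    have hdvd' := card_leftStab_dvd c₀ hc hcomm T₀ hcm (c₀ * w) hF'
    rw [filter_swap_mem c₀ hc hcomm T₀ hcm, filter_swap_not_mem c₀ hc hcomm T₀ hcm] at hdvd'
    obtain ⟨k', hk'⟩ := hdvd'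
    refine ⟨c₀ * w, hF', ⟨q₀, hq₀, by rw [mul_inv_central c₀ hc hcomm]; exact (hcm _).1 hq₀w⟩, ?_⟩
    rw [filter_swap_mem c₀ hc hcomm T₀ hcm, filter_swap_not_mem c₀ hc hcomm T₀ hcm]
    have hFpos := card_pos.2 ⟨q₀, hq₀F⟩
    have hk2 : 2 ≤ k' := by
      by_contra hk2
      rcases (show k' = 0 ∨ k' = 1 by omega) with rfl | rfl
      · rw [mul_zero] at hk'; omega
      · rw [mul_one] at hk'; omega
    calc 2 * _ ≤ k' * _ := Nat.mul_le_mul_right _ hk2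
      _ = _ := by rw [mul_comm, ← hk']

end Summit.HodgeConjecture.CorCM.GaloisModels.QuadraticStabiliser
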